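/-
Copyright: the m5 harness (cell B2b-5 `b2b-lgcu-borel`, generation 21).  Sorry-free; axioms: propext,
Classical.choice, Quot.sound.  VALUE = THEOREM (a budget-free, TPP-free exclusion law on the
level-one slice), NOT summit progress: the crux `SubgroupIdentityDesigns` is untouched.
-/
import Mathlib
import Literature.NumberTheory.EllipticCurves.BinaryQuarticDiscriminantFpCountProofs
import Summits.MatrixMultiplication.MatrixMultiplication.Theorems.SubgroupIdentityDesigns.Negative.ScalarLaw
import Summits.MatrixMultiplication.MatrixMultiplication.Theorems.SubgroupIdentityDesigns.Negative.LevelOneEquivariantDim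

/-!
# The admissibility principle for level-one delta carriers

Let `K ≤ GL_m(𝔽_p)` and suppose `K` CARRIES A LEVEL-ONE DELTA: some `f ∈ F_1` (level `≤ 1`
functions) has `f 1 = 1` and `f k = 0` for every `k ∈ K ∖ 1`.  Every member `Hᵢ` of a triple
`(H₁, H₂, H₃)` carrying a level-one identity design does (take the other two factors `= 1`), and so
does every subgroup of a member.  No TPP and no character budget is involved.

**THE PRINCIPLE** (`exists_mem_adm`).  If `K` carries a level-one delta then EVERY non-trivial
linear character `σ : K →* ℂˣ` has a `σ`-ADMISSIBLE vector: some `u : 𝔽_p^m` whose stabiliser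
`K_u` lies in `ker σ` (i.e. `ν_σ(K) ≥ 1`).

Proof.  The twisted probe `P(h) = Σ_{k ∈ K} σ(k) f(h k⁻¹)` lies in the `σ`-equivariant part
`(F_1)_σ` (`TwistedModuleLaw.probe_mem_eqvRight`) and `P(1) = f(1) = 1 ≠ 0`; but
`dim (F_1)_σ ≤ ν_σ(K) · b` (`LevelOneEquivariantDim.finrank_eqvRight_levelOne_le`), so
`ν_σ(K) = 0` would force `(F_1)_σ = 0`.

**COVERING EXCLUSION** (`false_of_cover`, `false_of_det_cover`).  Consequently, if the fixed
spaces `Fix(k)`, `k ∈ K` with `σ k ≠ 1`, COVER `𝔽_p^m`, then `K` carries no level-one delta; with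
`σ = χ ∘ det` (`χ(−1) ≠ 1`, which exists for `p` odd): if every vector is fixed by an element of
`K` of determinant `−1`, then `K` lies in NO member of ANY level-one witness — for every `p` odd,
every `m`, and EVERY `ε` (the statement does not see the budget).

**THE REFLECTION CONFIGURATION** (`reflFamily_not_subset_member`).  For `i₀ ≠ i₁` the `p + 1`
reflections `R_t = 1 − 2E_{i₀i₀} + 2tE_{i₀i₁}` (`t ∈ 𝔽_p`; fixed hyperplane `v_{i₀} = t v_{i₁}`) and
`R_∞ = 1 − 2E_{i₁i₁}` (fixed hyperplane `v_{i₁} = 0`) have determinant `−1` and their fixed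
hyperplanes — all hyperplanes containing `{v_{i₀} = v_{i₁} = 0}` — cover `𝔽_p^m`.  Hence NO MEMBER of
a level-one witness contains `{R_t} ∪ {R_∞}` (they generate the group `{[[±1,*],[0,±1]]} ⊕ 1` of
order `4p`), nor, by the general form, a block `O₂⁻(𝔽_p) ⊕ 1` (order `2(p+1)`) or the signed
monomial configuration `{diag(1,−1), diag(−1,1), antidiag(a,a⁻¹)} ⊕ 1` — tiny configurations far
below every order-counting bound (`N1`, `N2`, the window), which see only `|K|`.

Sanity data (`code/g21/adm_check.py`, pure Python): for 39 subgroups `K ≤ GL_m(𝔽_p)`, `(p,m) ∈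
{(3,2),(5,2),(7,2),(3,3),(5,3)}`, `δ_1|_K ∈ F_1|_K` (exact linear algebra) iff every `σ ≠ 1` has
`ν_σ(K) ≥ 1`; the three covering configurations above carry no delta; 0 violations.
-/

noncomputable section

open scoped BigOperators Classical Matrix

open Module (finrank)

namespace Summit.MatrixMultiplication.MatrixMultiplication.Theorems.SubgroupIdentityDesigns.Negative
namespace AdmissibilityPrinciple

open Literature.Barriers.MatrixMultiplication (SubgroupTPP)
open Summit.MatrixMultiplication.MatrixMultiplication.Theorems.LieRankDesigns.Negative (GLm Mat)
open Summit.MatrixMultiplication.MatrixMultiplication.Theorems.LevelOneGL2Designs.Negative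
  (levelSubmodule levelSubmodule_bi_inv)
open PackingBridge (exists_test)
open TwistedModuleLaw (eqvRight mem_eqvRight probe_mem_eqvRight)
open LevelOneInvariantDim (Ω orb exists_smul_eq_out)
open LevelOneEquivariantDim (adm mem_adm smul_mem_adm_iff AdmOrb card_admOrb_eq_zero
  finrank_eqvRight_levelOne_le)

variable {p m : ℕ} [hp : Fact p.Prime]

section Principle

/-- **THE ADMISSIBILITY PRINCIPLE.**  If `K ≤ GL_m(𝔽_p)` carries a level-one delta (`f ∈ F_1`,
`f 1 = 1`, `f = 0` on `K ∖ 1`) then every non-trivial linear character `σ` of `K` has a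
`σ`-admissible vector. -/
theorem exists_mem_adm {K : Subgroup (GLm p m)} {σ : K →* ℂˣ} (hσ : σ ≠ 1)
    {f : GLm p m → ℂ} (hf : f ∈ levelSubmodule p m 1) (h1 : f 1 = 1)
    (h0 : ∀ k : K, (k : GLm p m) ≠ 1 → f k = 0) : ∃ u : Fin m → ZMod p, u ∈ adm K σ := by
  by_contra hne
  rw [not_exists] at hne
  have hdim : finrank ℂ (eqvRight K σ (levelSubmodule p m 1)) = 0 := by
    have h := finrank_eqvRight_levelOne_le K hσ
    rw [card_admOrb_eq_zero K σ hne, zero_mul] at h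
    exact Nat.le_zero.1 h
  have hbot : eqvRight K σ (levelSubmodule p m 1) = ⊥ := Submodule.finrank_eq_zero.1 hdim
  have hP := probe_mem_eqvRight (levelSubmodule p m 1) levelSubmodule_bi_inv K σ hf 1 1
  rw [hbot, Submodule.mem_bot] at hP
  have hP1 := congr_fun hP 1
  simp only [inv_one, one_mul, mul_one, Pi.zero_apply] at hP1
  have hsum : (∑ k : K, ((σ k : ℂˣ) : ℂ) * f ((k : GLm p m)⁻¹)) = 1 := by
    rw [Finset.sum_eq_single (1 : K) (fun k _ hk => ?_) (fun h => absurd (Finset.mem_univ _) h)]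
    · rw [OneMemClass.coe_one, inv_one, h1, map_one, Units.val_one, one_mul]
    · have hk' : (((k⁻¹ : K) : K) : GLm p m) ≠ 1 := by
        rw [Ne, OneMemClass.coe_eq_one, inv_eq_one]
        exact hk
      rw [← Subgroup.coe_inv, h0 k⁻¹ hk', mul_zero]
  rw [hsum] at hP1
  exact one_ne_zero hP1

/-- Quantitative form: `ν_σ(K) ≥ 1`. -/
theorem one_le_card_admOrb {K : Subgroup (GLm p m)} {σ : K →* ℂˣ} (hσ : σ ≠ 1)
    {f : GLm p m → ℂ} (hf : f ∈ levelSubmodule p m 1) (h1 : f 1 = 1)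
    (h0 : ∀ k : K, (k : GLm p m) ≠ 1 → f k = 0) : 1 ≤ Nat.card (AdmOrb K σ) := by
  obtain ⟨u, hu⟩ := exists_mem_adm hσ hf h1 h0
  obtain ⟨k, hk⟩ := exists_smul_eq_out K u
  have hout : (orb K u).out ∈ adm K σ := by
    rw [← hk, smul_mem_adm_iff]
    exact hu
  haveI : Nonempty (AdmOrb K σ) := ⟨⟨orb K u, hout⟩⟩
  exact Nat.card_pos

/-- If the fixed spaces of the elements of `K` outside `ker σ` cover `𝔽_p^m`, no vector is
admissible. -/
theorem not_mem_adm_of_cover {K : Subgroup (GLm p m)} {σ : K →* ℂˣ}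
    (hcov : ∀ u : Fin m → ZMod p, ∃ k : K, k • u = u ∧ σ k ≠ 1) (u : Fin m → ZMod p) :
    u ∉ adm K σ := fun hu => by
  obtain ⟨k, hk, hσ⟩ := hcov u
  exact hσ (hu k hk)

/-- **COVERING EXCLUSION.**  If the fixed spaces of the elements of `K` outside `ker σ` cover
`𝔽_p^m`, then `K` carries no level-one delta. -/
theorem false_of_cover {K : Subgroup (GLm p m)} {σ : K →* ℂˣ}
    (hcov : ∀ u : Fin m → ZMod p, ∃ k : K, k • u = u ∧ σ k ≠ 1)
    {f : GLm p m → ℂ} (hf : f ∈ levelSubmodule p m 1) (h1 : f 1 = 1)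
    (h0 : ∀ k : K, (k : GLm p m) ≠ 1 → f k = 0) : False := by
  have hσ : σ ≠ 1 := by
    obtain ⟨k, -, hk⟩ := hcov 0
    rintro rfl
    exact hk (MonoidHom.one_apply k)
  obtain ⟨u, hu⟩ := exists_mem_adm hσ hf h1 h0
  exact not_mem_adm_of_cover hcov u hu

end Principle

section Members

variable {G : Type} [Group G]

/-- An identity test vanishes on `H₁ ∖ 1`. -/
theorem vanish_left {H₁ H₂ H₃ : Subgroup G} {f : G → ℂ}
    (h0 : ∀ a ∈ H₁, ∀ b ∈ H₂, ∀ c ∈ H₃, a * b * c ≠ 1 → f (a * b * c) = 0) :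
    ∀ a ∈ H₁, a ≠ 1 → f a = 0 := fun a ha hne => by
  simpa using h0 a ha 1 H₂.one_mem 1 H₃.one_mem (by simpa using hne)

/-- An identity test vanishes on `H₂ ∖ 1`. -/
theorem vanish_middle {H₁ H₂ H₃ : Subgroup G} {f : G → ℂ}
    (h0 : ∀ a ∈ H₁, ∀ b ∈ H₂, ∀ c ∈ H₃, a * b * c ≠ 1 → f (a * b * c) = 0) :
    ∀ b ∈ H₂, b ≠ 1 → f b = 0 := fun b hb hne => by
  simpa using h0 1 H₁.one_mem b hb 1 H₃.one_mem (by simpa using hne)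

/-- An identity test vanishes on `H₃ ∖ 1`. -/
theorem vanish_right {H₁ H₂ H₃ : Subgroup G} {f : G → ℂ}
    (h0 : ∀ a ∈ H₁, ∀ b ∈ H₂, ∀ c ∈ H₃, a * b * c ≠ 1 → f (a * b * c) = 0) :
    ∀ c ∈ H₃, c ≠ 1 → f c = 0 := fun c hc hne => by
  simpa using h0 1 H₁.one_mem 1 H₂.one_mem c hc (by simpa using hne)

/-- Every subgroup of a member of a triple carrying an identity test carries the delta. -/
theorem vanish_of_le {H₁ H₂ H₃ : Subgroup G} {f : G → ℂ}
    (h0 : ∀ a ∈ H₁, ∀ b ∈ H₂, ∀ c ∈ H₃, a * b * c ≠ 1 → f (a * b * c) = 0)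
    {K : Subgroup G} (hK : K ≤ H₁ ∨ K ≤ H₂ ∨ K ≤ H₃) : ∀ k : K, (k : G) ≠ 1 → f k = 0 := by
  intro k hk
  rcases hK with h | h | h
  · exact vanish_left h0 _ (h k.2) hk
  · exact vanish_middle h0 _ (h k.2) hk
  · exact vanish_right h0 _ (h k.2) hk

/-- **THE PRINCIPLE FOR MEMBERS.**  In a triple carrying a level-one identity test, every
non-trivial linear character of every subgroup `K` of a member has an admissible vector
(`ν_σ(K) ≥ 1`).  No TPP, no budget. -/
theorem member_one_le_card_admOrb {H₁ H₂ H₃ : Subgroup (GLm p m)} {f : GLm p m → ℂ}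
    (hf : f ∈ levelSubmodule p m 1) (h1 : f 1 = 1)
    (h0 : ∀ a ∈ H₁, ∀ b ∈ H₂, ∀ c ∈ H₃, a * b * c ≠ 1 → f (a * b * c) = 0)
    {K : Subgroup (GLm p m)} (hK : K ≤ H₁ ∨ K ≤ H₂ ∨ K ≤ H₃) {σ : K →* ℂˣ} (hσ : σ ≠ 1) :
    1 ≤ Nat.card (AdmOrb K σ) :=
  one_le_card_admOrb hσ hf h1 (vanish_of_le h0 hK)

end Members

section Determinant




/-- For `p` odd there is a character `χ` of `𝔽_pˣ` with `χ(−1) ≠ 1` (duality of finite abelian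
groups; `ℂ` has enough roots of unity). -/
theorem exists_unitChar_neg_one (hp2 : p ≠ 2) : ∃ χ : (ZMod p)ˣ →* ℂˣ, χ (-1) ≠ 1 := by
  haveI : NeZero ((Monoid.exponent (ZMod p)ˣ : ℕ) : ℂ) :=
    ⟨Nat.cast_ne_zero.2 Monoid.exponent_ne_zero_of_finite⟩
  exact CommGroup.exists_apply_ne_one_of_hasEnoughRootsOfUnity (ZMod p)ˣ ℂ
    (neg_one_ne_one_units hp2)

/-- **DETERMINANT COVERING EXCLUSION.**  For `p` odd: if every vector of `𝔽_p^m` is fixed by an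
element of `K` of determinant `−1`, then `K` carries no level-one delta. -/
theorem false_of_det_cover (hp2 : p ≠ 2) {K : Subgroup (GLm p m)}
    (hcov : ∀ u : Fin m → ZMod p, ∃ k : K, k • u = u ∧
      Matrix.GeneralLinearGroup.det (k : GLm p m) = -1)
    {f : GLm p m → ℂ} (hf : f ∈ levelSubmodule p m 1) (h1 : f 1 = 1)
    (h0 : ∀ k : K, (k : GLm p m) ≠ 1 → f k = 0) : False := by
  obtain ⟨χ, hχ⟩ := exists_unitChar_neg_one (p := p) hp2
  refine false_of_cover (σ := χ.comp (Matrix.GeneralLinearGroup.det.comp K.subtype))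
    (fun u => ?_) hf h1 h0
  obtain ⟨k, hk, hdet⟩ := hcov u
  refine ⟨k, hk, ?_⟩
  show χ (Matrix.GeneralLinearGroup.det (k : GLm p m)) ≠ 1
  rw [hdet]
  exact hχ

end Determinant

section Reflections

variable {i₀ i₁ : Fin m}

/-- The row `−e_{i₀} + 2t e_{i₁}`. -/
def reflRow (i₀ i₁ : Fin m) (t : ZMod p) : Fin m → ZMod p :=
  fun j => if i₀ = j then -1 else if i₁ = j then 2 * t else 0

/-- The reflection matrix `R_t = 1 − 2E_{i₀i₀} + 2tE_{i₀i₁}` (row `i₀` of `1` replaced). -/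
def reflMat (i₀ i₁ : Fin m) (t : ZMod p) : Mat p m := Matrix.updateRow 1 i₀ (reflRow i₀ i₁ t)

/-- `reflRow = (−1) · (row i₀ of 1) + 2t · (row i₁ of 1)`. -/
theorem reflRow_eq (h : i₀ ≠ i₁) (t : ZMod p) :
    reflRow i₀ i₁ t = (-1 : ZMod p) • (1 : Mat p m) i₀ + (2 * t) • (1 : Mat p m) i₁ := by
  funext j
  simp only [reflRow, Pi.add_apply, Pi.smul_apply, Matrix.one_apply, smul_eq_mul, mul_ite,
    mul_one, mul_zero]
  by_cases hj0 : i₀ = j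
  · have hj1 : ¬i₁ = j := fun e => h (hj0.trans e.symm)
    rw [if_pos hj0, if_pos hj0, if_neg hj1, add_zero]
  · rw [if_neg hj0, if_neg hj0, zero_add]

/-- `det R_t = −1`. -/
theorem det_reflMat (h : i₀ ≠ i₁) (t : ZMod p) : (reflMat i₀ i₁ t).det = -1 := by
  rw [reflMat, reflRow_eq h, Matrix.det_updateRow_add, Matrix.det_updateRow_smul,
    Matrix.det_updateRow_smul, Matrix.updateRow_eq_self, Matrix.det_one,
    Matrix.det_updateRow_eq_zero (Ne.symm h)]
  ring

/-- The action of `R_t`: `(R_t v)_{i₀} = −v_{i₀} + 2t v_{i₁}`, other coordinates unchanged. -/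
theorem reflMat_mulVec (h : i₀ ≠ i₁) (t : ZMod p) (v : Fin m → ZMod p) (j : Fin m) :
    (reflMat i₀ i₁ t *ᵥ v) j = if j = i₀ then -v i₀ + 2 * t * v i₁ else v j := by
  have e1 : ∀ i, ((1 : Mat p m) *ᵥ v) i = v i := fun i => by rw [Matrix.one_mulVec]
  simp only [Matrix.mulVec, dotProduct] at e1 ⊢
  simp only [reflMat, Matrix.updateRow_apply]
  by_cases hj : j = i₀
  · simp only [if_pos hj]
    rw [reflRow_eq h]
    simp only [Pi.add_apply, Pi.smul_apply, smul_eq_mul, add_mul, Finset.sum_add_distrib,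
      mul_assoc, ← Finset.mul_sum]
    rw [e1 i₀, e1 i₁]
    ring
  · simp only [if_neg hj]
    exact e1 j

/-- The reflection `R_t` as an element of `GL_m(𝔽_p)`. -/
def refl (h : i₀ ≠ i₁) (t : ZMod p) : GLm p m :=
  Matrix.GeneralLinearGroup.mkOfDetNeZero (reflMat i₀ i₁ t)
    (by rw [det_reflMat h]; exact neg_ne_zero.2 one_ne_zero)

/-- Underlying matrix of `refl`. -/
theorem coe_refl (h : i₀ ≠ i₁) (t : ZMod p) : ((refl h t : GLm p m) : Mat p m) = reflMat i₀ i₁ t :=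
  rfl

/-- `det (refl h t) = −1` in `𝔽_pˣ`. -/
theorem det_refl (h : i₀ ≠ i₁) (t : ZMod p) :
    Matrix.GeneralLinearGroup.det (refl h t : GLm p m) = -1 :=
  Units.ext (by
    rw [Matrix.GeneralLinearGroup.val_det_apply, coe_refl, det_reflMat h, Units.val_neg,
      Units.val_one])

/-- The action of `refl h t` on vectors. -/
theorem refl_smul_apply (h : i₀ ≠ i₁) (t : ZMod p) (v : Fin m → ZMod p) (j : Fin m) :
    (refl h t • v) j = if j = i₀ then -v i₀ + 2 * t * v i₁ else v j := by
  show ((refl h t : Mat p m) *ᵥ v) j = _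
  rw [coe_refl, reflMat_mulVec h]

/-- Fixed vectors of `R_t` (`p` odd): the hyperplane `v_{i₀} = t v_{i₁}`. -/
theorem refl_smul_eq_self_iff (hp2 : p ≠ 2) (h : i₀ ≠ i₁) (t : ZMod p) (v : Fin m → ZMod p) :
    refl h t • v = v ↔ v i₀ = t * v i₁ := by
  constructor
  · intro hv
    have h0 := congr_fun hv i₀
    rw [refl_smul_apply, if_pos rfl] at h0
    apply mul_left_cancel₀ (Literature.NumberTheory.EllipticCurves.BinaryQuartic.two_ne_zero_zmod hp2)
    linear_combination (-1 : ZMod p) * h0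
  · intro hv
    funext j
    rw [refl_smul_apply]
    by_cases hj : j = i₀
    · rw [if_pos hj, hj, hv]; ring
    · rw [if_neg hj]

/-- The REFLECTION CONFIGURATION of the coordinate plane `(i₀, i₁)`: the `p + 1` reflections
`R_t` (`t ∈ 𝔽_p`) and `R_∞ = refl h.symm 0` (fixed hyperplane `v_{i₁} = 0`). -/
def reflFamily (h : i₀ ≠ i₁) : Set (GLm p m) :=
  insert (refl (p := p) h.symm 0) (Set.range (refl (p := p) h))

/-- The fixed hyperplanes of the reflection configuration cover `𝔽_p^m`, by elements of
determinant `−1`. -/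
theorem refl_cover (hp2 : p ≠ 2) (h : i₀ ≠ i₁) (u : Fin m → ZMod p) :
    ∃ g ∈ reflFamily (p := p) h, g • u = u ∧ Matrix.GeneralLinearGroup.det g = -1 := by
  by_cases hu : u i₁ = 0
  · refine ⟨refl h.symm 0, Set.mem_insert _ _, ?_, det_refl h.symm 0⟩
    rw [refl_smul_eq_self_iff hp2, hu, zero_mul]
  · refine ⟨refl h (u i₀ * (u i₁)⁻¹), Set.mem_insert_of_mem _ ⟨_, rfl⟩, ?_, det_refl h _⟩
    rw [refl_smul_eq_self_iff hp2, inv_mul_cancel_right₀ hu]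

/-- **NO LEVEL-ONE DELTA ON A GROUP CONTAINING THE REFLECTION CONFIGURATION** (`p` odd). -/
theorem false_of_reflFamily_subset (hp2 : p ≠ 2) (h : i₀ ≠ i₁) {K : Subgroup (GLm p m)}
    (hK : reflFamily (p := p) h ⊆ K) {f : GLm p m → ℂ} (hf : f ∈ levelSubmodule p m 1)
    (h1 : f 1 = 1) (h0 : ∀ k : K, (k : GLm p m) ≠ 1 → f k = 0) : False :=
  false_of_det_cover hp2 (fun u => by
    obtain ⟨g, hg, hgu, hdet⟩ := refl_cover hp2 h u
    exact ⟨⟨g, hK hg⟩, hgu, hdet⟩) hf h1 h0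

/-- **THE REFLECTION CONFIGURATION LIES IN NO MEMBER** of a triple carrying a level-one identity
test (`p` odd, any `m ≥ 2`, any test; no TPP, no budget). -/
theorem reflFamily_not_subset_member_of_test (hp2 : p ≠ 2) (h : i₀ ≠ i₁)
    {H₁ H₂ H₃ : Subgroup (GLm p m)} {f : GLm p m → ℂ} (hf : f ∈ levelSubmodule p m 1)
    (h1 : f 1 = 1) (h0 : ∀ a ∈ H₁, ∀ b ∈ H₂, ∀ c ∈ H₃, a * b * c ≠ 1 → f (a * b * c) = 0) :
    ¬reflFamily (p := p) h ⊆ H₁ ∧ ¬reflFamily (p := p) h ⊆ H₂ ∧ ¬reflFamily (p := p) h ⊆ H₃ :=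
  ⟨fun hs => false_of_reflFamily_subset hp2 h hs hf h1 (vanish_of_le h0 (Or.inl le_rfl)),
   fun hs => false_of_reflFamily_subset hp2 h hs hf h1 (vanish_of_le h0 (Or.inr (Or.inl le_rfl))),
   fun hs => false_of_reflFamily_subset hp2 h hs hf h1
    (vanish_of_le h0 (Or.inr (Or.inr le_rfl)))⟩

end Reflections

section Crux

variable {i₀ i₁ : Fin m}

/-- **CRUX FORM.**  For every triple `(H₁, H₂, H₃) ≤ GL_m(𝔽_p)` (`p` odd) satisfying the
level-ONE identity-design clause of `SubgroupIdentityDesigns` verbatim — with or WITHOUT the TPP,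
and for EVERY `ε` (the character budget is not used) — no member contains the reflection
configuration `{R_t : t ∈ 𝔽_p} ∪ {R_∞}` of any coordinate plane (equivalently, by
`Subgroup.closure_le`, the group `{[[±1,*],[0,±1]]} ⊕ 1` of order `4p` it generates). -/
theorem reflFamily_not_subset_member (hp2 : p ≠ 2) (h : i₀ ≠ i₁)
    {H₁ H₂ H₃ : Subgroup (GLm p m)}
    (hdes : ∃ c : Mat p m → ℂ, (∀ M, 1 < M.rank → c M = 0) ∧
      (∑ M, c M * ZMod.stdAddChar (Matrix.trace (M * ((1 : GLm p m) : Mat p m)))) = 1 ∧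
      ∀ a ∈ H₁, ∀ b ∈ H₂, ∀ g ∈ H₃, a * b * g ≠ 1 →
        (∑ M, c M * ZMod.stdAddChar (Matrix.trace (M * ((a * b * g : GLm p m) : Mat p m)))) = 0) :
    ¬reflFamily (p := p) h ⊆ H₁ ∧ ¬reflFamily (p := p) h ⊆ H₂ ∧ ¬reflFamily (p := p) h ⊆ H₃ := by
  obtain ⟨f, hf, h1, h0⟩ := exists_test hdes
  exact reflFamily_not_subset_member_of_test hp2 h hf h1 h0

/-- **CRUX FORM OF THE PRINCIPLE.**  In every triple satisfying the level-one identity-design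
clause verbatim, every non-trivial linear character of every subgroup of a member has an admissible
vector: `ν_σ(K) ≥ 1`.  (Compare `CharacterLaw`: under the TPP and the window, `ν_σ(K) ≥ 2`.) -/
theorem crux_one_le_card_admOrb {H₁ H₂ H₃ : Subgroup (GLm p m)}
    (hdes : ∃ c : Mat p m → ℂ, (∀ M, 1 < M.rank → c M = 0) ∧
      (∑ M, c M * ZMod.stdAddChar (Matrix.trace (M * ((1 : GLm p m) : Mat p m)))) = 1 ∧
      ∀ a ∈ H₁, ∀ b ∈ H₂, ∀ g ∈ H₃, a * b * g ≠ 1 →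
        (∑ M, c M * ZMod.stdAddChar (Matrix.trace (M * ((a * b * g : GLm p m) : Mat p m)))) = 0)
    {K : Subgroup (GLm p m)} (hK : K ≤ H₁ ∨ K ≤ H₂ ∨ K ≤ H₃) {σ : K →* ℂˣ} (hσ : σ ≠ 1) :
    1 ≤ Nat.card (AdmOrb K σ) := by
  obtain ⟨f, hf, h1, h0⟩ := exists_test hdes
  exact member_one_le_card_admOrb hf h1 h0 hK hσ

/-- **CRUX FORM OF THE DETERMINANT COVERING EXCLUSION** (`p` odd): a subgroup `K` in which every
vector is fixed by an element of determinant `−1` (e.g. `O₂⁻(𝔽_p) ⊕ 1`, the reflection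
configuration, the signed monomial configuration of a plane) lies in no member. -/
theorem crux_det_cover_not_le_member (hp2 : p ≠ 2) {H₁ H₂ H₃ : Subgroup (GLm p m)}
    (hdes : ∃ c : Mat p m → ℂ, (∀ M, 1 < M.rank → c M = 0) ∧
      (∑ M, c M * ZMod.stdAddChar (Matrix.trace (M * ((1 : GLm p m) : Mat p m)))) = 1 ∧
      ∀ a ∈ H₁, ∀ b ∈ H₂, ∀ g ∈ H₃, a * b * g ≠ 1 →
        (∑ M, c M * ZMod.stdAddChar (Matrix.trace (M * ((a * b * g : GLm p m) : Mat p m)))) = 0)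
    {K : Subgroup (GLm p m)}
    (hcov : ∀ u : Fin m → ZMod p, ∃ k : K, k • u = u ∧
      Matrix.GeneralLinearGroup.det (k : GLm p m) = -1) :
    ¬K ≤ H₁ ∧ ¬K ≤ H₂ ∧ ¬K ≤ H₃ := by
  obtain ⟨f, hf, h1, h0⟩ := exists_test hdes
  exact ⟨fun h => false_of_det_cover hp2 hcov hf h1 (vanish_of_le h0 (Or.inl h)),
    fun h => false_of_det_cover hp2 hcov hf h1 (vanish_of_le h0 (Or.inr (Or.inl h))),
    fun h => false_of_det_cover hp2 hcov hf h1 (vanish_of_le h0 (Or.inr (Or.inr h)))⟩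

end Crux

end AdmissibilityPrinciple
end Summit.MatrixMultiplication.MatrixMultiplication.Theorems.SubgroupIdentityDesigns.Negative

end
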